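import Mathlib
import Summits.KontsevichZagierPeriods.Zeta5Search.LaiGrowthFactorials
import Summits.KontsevichZagierPeriods.Zeta5Search.LaiPhiTilde
import Summits.KontsevichZagierPeriods.Zeta5Search.WellPoisedFaceBoundaryRate
import Summits.KontsevichZagierPeriods.Zeta5Search.Certificates.LogEnclosures
import Summits.KontsevichZagierPeriods.Zeta5Search.Criteria
import HarnessLib

/-!
# ζ(5) search — growth side of Lai's box function, part 4: the exponential RATE `β̃` (Stirling) and the
# skeleton's `growth` field at the κ₃ candidate point (fam-indep, κ₃ ladder, gen 5)

HONEST FRAMING: systematic search; no irrationality claim unless certified.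

OUR work (Summit side; cell `pub-zeta5`, family `indep`, planner seat gen 5, STAGED for the lane). Part 3
(`LaiGrowthFactorials.lean`) bounds every normalised coefficient `|C_n c_{s−1,k}|` of Lai's very-well-poised box
function by `laiGAbsBound · laiGWidth^{J−s}`, uniformly in the pole index `0 ≤ k ≤ Mn`, with
`laiGAbsBound = (Mn+2)·((M'n+rn)!/(M'n)!)²/n!^{2r}·∏_j 2^{(M−2δ_j)n}` for even `M = 2M'`. Here we finish the
`growth` / `β` input of the typed κ₃ certificate `LaiBoxInputs` (tree, p242857):

* `harm_nonneg`, `harm_le_natCast` — `0 ≤ H_p^{(i)} ≤ p` (archimedean size of the rational part's weights);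
* `abs_mul_laiCoef_le_of_pf_bound` — the k-SUM STEP in abstract form: a pole-uniform bound `|C c_{s−1,p}| ≤ B·W^{J−s}`
  gives `|C · laiCoef n s| ≤ (J+1)(Mn+1)²·B·W^J` for EVERY `s` (the `ζ(s)`-coefficients are sums of `Mn+1` terms, the
  rational part `s = 0` a double sum weighted by `H_p^{(o+1)} ≤ Mn+1`, and `laiCoef = 0` beyond `J`);
  `abs_laiC_mul_laiCoef_le` — its instance with part 3's bound: `|C_n · laiCoef n s| ≤ laiCoefMajorant`;
* `laiBeta J r M' δ = 2(M'+r)log(M'+r) − 2M' log M' + log 2·Σ_j(2M'−2δ_j)` — Lai's `β̃ = (2r+M)log((2r+M)/2) −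
  M log(M/2) + log 2·Σ_j(M−2δ_j)` for `M = 2M'` ([Lai2024BallRivoal, Lemma 5.2 / §13 p. 49]) — and the RATES
  `tendsto_log_laiGAbsBound_div` (`(1/n) log laiGAbsBound → β̃`, by Stirling in the form `log m! = m log m − m + E(m)`,
  `E(αn)/n → 0` of the tree's `WellPoisedFaceRate`), `tendsto_log_laiGWidth_div` (`→ 0`, polynomial width),
  `tendsto_log_laiCoefMajorant_div` (`→ β̃`);
* **`laiCoef_growth`** — the skeleton's `growth` field for the brick data: for every `s` and every `β' > β̃`,
  `|C_n · laiCoef n s| ≤ e^{β' n}` eventually;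
* section `Kappa3`: **`kappa3_growth`** = the `growth` field of `LaiBoxInputs 74 2180 444 δ74 36` with
  `β := kappa3Beta = laiBeta 74 2180 222 δ74`, its closed form `kappa3Beta_eq : β̃ = 4804 log 2402 − 444 log 222 +
  26070 log 2`, and the certified enclosure `kappa3Beta_bounds : 53066.168 ≤ β̃ ≤ 53066.1682` (tree `LogEnclosures`;
  KAPPA3.md §7 prints `β̃ = 53066.16808…`).

With this file the fields `coef, hasSum, C, Dm, Φ, Φ_pos, c, isInt, dvd3` (part `LaiPhiTilde`, section `Kappa3`) AND
`β, growth` of the candidate certificate are closed-form theorems; `α/decay`, `ϖ/savingRate` and the three numeric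
inequalities remain OPEN (families/indep/FAMILY.md §5.13). MANUSCRIPT-LEVEL CANDIDATE, NOT certified: nothing here is
a margin or dimension statement.

References: [Lai2024BallRivoal] L. Lai, arXiv:2407.14236, Lemma 5.2, (5.14)–(5.16), §13 p. 49 (the value of `β̃`);
[Zudilin2004] W. Zudilin, J. Théor. Nombres Bordeaux 16 (2004), §7 Lemma 17.
-/

open Finset Filter Literature.NumberTheory.Transcendental Literature.Analysis.Calculus
open scoped Nat Topology

namespace Summit.KontsevichZagierPeriods.Zeta5Search

open Literature.NumberTheory.Transcendental.BallRivoal (harm)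
open WellPoisedFaceRate (logFactErr log_factorial_eq tendsto_logFactErr_mul_div tendsto_log_linear_div
  cast_mul_log_mul)

noncomputable section

/-! ### Archimedean size of the harmonic weights -/

/-- `0 ≤ H_p^{(i)}`. [folklore] -/
theorem harm_nonneg (i p : ℕ) : 0 ≤ harm i p :=
  sum_nonneg fun m _ => by positivity

/-- `H_p^{(i)} ≤ p` (each of the `p` terms is at most `1`). [folklore] -/
theorem harm_le_natCast (i p : ℕ) : harm i p ≤ p := by
  have h : ∀ m ∈ range p, 1 / ((m : ℚ) + 1) ^ i ≤ 1 := fun m _ => by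
    rw [div_le_one (by positivity)]
    exact one_le_pow₀ (by have := (Nat.cast_nonneg m : (0:ℚ) ≤ m); linarith)
  calc harm i p = ∑ m ∈ range p, 1 / ((m : ℚ) + 1) ^ i := rfl
    _ ≤ ∑ _m ∈ range p, (1 : ℚ) := sum_le_sum h
    _ = p := by simp

/-! ### The k-sum step (abstract) -/

/-- ABSTRACT k-SUM STEP: a bound `|C c_{s−1,p}| ≤ B·W^{J−s}` (`1 ≤ s ≤ J`, `0 ≤ p ≤ Mn`) uniform in the pole index
gives `|C · laiCoef n s| ≤ (J+1)(Mn+1)² · B · W^J` for EVERY `s`. [this file] -/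
theorem abs_mul_laiCoef_le_of_pf_bound (J M n : ℕ) (C : ℚ) (c : ℕ → ℕ → ℕ → ℚ) {B W : ℚ} (hB : 0 ≤ B)
    (hW : 1 ≤ W) (hone : ∀ s, 1 ≤ s → s ≤ J → ∀ p, p ≤ M * n → |C * c n (s - 1) p| ≤ B * W ^ (J - s)) (s : ℕ) :
    |C * laiCoef J M c n s| ≤ (((J + 1) * (M * n + 1) ^ 2 : ℕ) : ℚ) * (B * W ^ J) := by
  have hX : 0 ≤ B * W ^ J := mul_nonneg hB (pow_nonneg (zero_le_one.trans hW) _)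
  have hWJ : ∀ e, B * W ^ (J - e) ≤ B * W ^ J := fun e =>
    mul_le_mul_of_nonneg_left (pow_le_pow_right₀ hW (Nat.sub_le J e)) hB
  have hone' : ∀ o, o < J → ∀ p ∈ range (M * n + 1), |C * c n o p| ≤ B * W ^ J := by
    intro o ho p hp
    have h := hone (o + 1) (by omega) (by omega) p (Nat.lt_succ_iff.1 (mem_range.1 hp))
    simp only [Nat.add_sub_cancel] at h
    exact h.trans (hWJ _)
  have hm : (0 : ℚ) ≤ (M : ℚ) * n := by positivity
  have hJ : (0 : ℚ) ≤ J := by positivity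
  rcases Nat.eq_zero_or_pos s with rfl | hs
  · have h0 : laiCoef J M c n 0 = -∑ o ∈ range J, ∑ p ∈ range (M * n + 1), c n o p * harm (o + 1) p := by
      simp [laiCoef]
    rw [h0, mul_neg, abs_neg, mul_sum]
    calc |∑ o ∈ range J, C * ∑ p ∈ range (M * n + 1), c n o p * harm (o + 1) p|
        ≤ ∑ o ∈ range J, |C * ∑ p ∈ range (M * n + 1), c n o p * harm (o + 1) p| := abs_sum_le_sum_abs _ _
      _ ≤ ∑ o ∈ range J, ∑ p ∈ range (M * n + 1), B * W ^ J * ((M * n + 1 : ℕ) : ℚ) := by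
          refine sum_le_sum fun o ho => ?_
          rw [mul_sum]
          refine (abs_sum_le_sum_abs _ _).trans (sum_le_sum fun p hp => ?_)
          rw [← mul_assoc, abs_mul]
          have hp' : p ≤ M * n := Nat.lt_succ_iff.1 (mem_range.1 hp)
          have hh : |harm (o + 1) p| ≤ ((M * n + 1 : ℕ) : ℚ) := by
            rw [abs_of_nonneg (harm_nonneg _ _)]
            exact (harm_le_natCast _ _).trans (by exact_mod_cast Nat.le_succ_of_le hp')
          exact mul_le_mul (hone' o (mem_range.1 ho) p hp) hh (abs_nonneg _) hX
      _ = (J : ℚ) * (((M * n + 1 : ℕ) : ℚ) * (B * W ^ J * ((M * n + 1 : ℕ) : ℚ))) := by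
          rw [sum_const, card_range, nsmul_eq_mul, sum_const, card_range, nsmul_eq_mul]
      _ ≤ (((J + 1) * (M * n + 1) ^ 2 : ℕ) : ℚ) * (B * W ^ J) := by
          push_cast
          nlinarith [mul_nonneg (sq_nonneg ((M : ℚ) * n + 1)) hX]
  · by_cases hsJ : s ≤ J
    · have h1 : laiCoef J M c n s = ∑ p ∈ range (M * n + 1), c n (s - 1) p := by
        simp [laiCoef, show s ≠ 0 by omega, hsJ]
      rw [h1, mul_sum]
      calc |∑ p ∈ range (M * n + 1), C * c n (s - 1) p|
          ≤ ∑ p ∈ range (M * n + 1), |C * c n (s - 1) p| := abs_sum_le_sum_abs _ _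
        _ ≤ ∑ _p ∈ range (M * n + 1), B * W ^ J := sum_le_sum fun p hp => hone' (s - 1) (by omega) p hp
        _ = ((M * n + 1 : ℕ) : ℚ) * (B * W ^ J) := by rw [sum_const, card_range, nsmul_eq_mul]
        _ ≤ (((J + 1) * (M * n + 1) ^ 2 : ℕ) : ℚ) * (B * W ^ J) := by
            push_cast
            nlinarith [mul_nonneg hm hX, mul_nonneg hJ (mul_nonneg (sq_nonneg ((M : ℚ) * n + 1)) hX),
              mul_nonneg (mul_nonneg hm hm) hX]
    · have h1 : laiCoef J M c n s = 0 := by simp [laiCoef, show s ≠ 0 by omega, hsJ]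
      rw [h1, mul_zero, abs_zero]
      positivity

/-! ### The rate of `laiGAbsBound` (Stirling) -/

/-- `0 < laiGAbsBound`. [folklore] -/
theorem laiGAbsBound_pos (J r M n : ℕ) (δ : Fin J → ℕ) : 0 < laiGAbsBound J r M n δ := by
  unfold laiGAbsBound; positivity

/-- Even `M = 2M'`: `laiGAbsBound = (2M'n+2) · ((M'n+rn)!/(M'n)!)² / n!^{2r} · ∏_j 2^{(2M'−2δ_j)n}`. [this file] -/
theorem laiGAbsBound_two_mul (J r M' n : ℕ) (δ : Fin J → ℕ) :
    laiGAbsBound J r (2 * M') n δ =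
      (((2 * M' * n + 2 : ℕ) : ℚ)) * (((((M' * n + r * n)! : ℕ) : ℚ) / ((M' * n)! : ℚ)) ^ 2 / (n ! : ℚ) ^ (2 * r)) *
        ∏ j : Fin J, (2 : ℚ) ^ ((2 * M' - 2 * δ j) * n) := by
  unfold laiGAbsBound
  rw [prod_central_two_mul]

/-- Lai's growth exponent for even `M = 2M'`: `β̃ = 2(M'+r) log(M'+r) − 2M' log M' + log 2 · Σ_j (2M' − 2δ_j)`
(`= (2r+M) log((2r+M)/2) − M log(M/2) + log 2 · Σ_j (M − 2δ_j)`). [cite: Lai2024BallRivoal, Lemma 5.2] -/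
def laiBeta (J r M' : ℕ) (δ : Fin J → ℕ) : ℝ :=
  2 * (((M' : ℝ) + r) * Real.log ((M' : ℝ) + r)) - 2 * ((M' : ℝ) * Real.log M') +
    Real.log 2 * ∑ j : Fin J, (((2 * M' - 2 * δ j : ℕ)) : ℝ)

/-- The logarithm of the bound, explicitly. [this file] -/
theorem log_laiGAbsBound_two_mul (J r M' n : ℕ) (δ : Fin J → ℕ) :
    Real.log ((laiGAbsBound J r (2 * M') n δ : ℚ) : ℝ) =
      Real.log ((2 : ℝ) * M' * n + 2) +
        (2 * (Real.log ((((M' + r) * n)! : ℕ) : ℝ) - Real.log (((M' * n)! : ℕ) : ℝ)) -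
          2 * (r : ℝ) * Real.log ((n ! : ℕ) : ℝ)) +
        (∑ j : Fin J, (((2 * M' - 2 * δ j : ℕ)) : ℝ)) * n * Real.log 2 := by
  rw [laiGAbsBound_two_mul, show M' * n + r * n = (M' + r) * n by ring]
  have hA : ((2 : ℝ) * M' * n + 2) ≠ 0 := by positivity
  have ha : ((((M' + r) * n)! : ℕ) : ℝ) ≠ 0 := by positivity
  have hb : (((M' * n)! : ℕ) : ℝ) ≠ 0 := by positivity
  have hc : ((n ! : ℕ) : ℝ) ^ (2 * r) ≠ 0 := by positivity
  have hq : (((((M' + r) * n)! : ℕ) : ℝ) / (((M' * n)! : ℕ) : ℝ)) ^ 2 ≠ 0 := by positivity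
  have hB : (((((M' + r) * n)! : ℕ) : ℝ) / (((M' * n)! : ℕ) : ℝ)) ^ 2 / ((n ! : ℕ) : ℝ) ^ (2 * r) ≠ 0 := by
    positivity
  have hC : ∏ j : Fin J, (2 : ℝ) ^ ((2 * M' - 2 * δ j) * n) ≠ 0 := by positivity
  push_cast
  rw [Real.log_mul (mul_ne_zero hA hB) hC, Real.log_mul hA hB, Real.log_div hq hc, Real.log_pow, Real.log_pow,
    Real.log_div ha hb, Real.log_prod fun j _ => by positivity]
  simp only [Real.log_pow]
  push_cast
  simp only [← Finset.sum_mul]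

/-- **Rate of the centre bound**: `(1/n) log laiGAbsBound → β̃` for even `M = 2M'`. [cite: Lai2024BallRivoal, §13 p. 49]
(our proof: Stirling via `WellPoisedFaceRate.logFactErr`) -/
theorem tendsto_log_laiGAbsBound_div (J r M' : ℕ) (δ : Fin J → ℕ) :
    Tendsto (fun n : ℕ => Real.log ((laiGAbsBound J r (2 * M') n δ : ℚ) : ℝ) / n) atTop (𝓝 (laiBeta J r M' δ)) := by
  set L : ℝ := laiBeta J r M' δ with hL
  have hE1 : Tendsto (fun n : ℕ => logFactErr n / n) atTop (𝓝 0) := by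
    simpa using tendsto_logFactErr_mul_div 1
  have hE : Tendsto (fun n : ℕ => Real.log ((2 : ℝ) * M' * n + 2) / n + 2 * (logFactErr ((M' + r) * n) / n)
      - 2 * (logFactErr (M' * n) / n) - 2 * r * (logFactErr n / n)) atTop (𝓝 (0 + 2 * 0 - 2 * 0 - 2 * r * 0)) := by
    refine (((?_ : Tendsto _ _ _).add ((tendsto_logFactErr_mul_div (M' + r)).const_mul 2)).sub
      ((tendsto_logFactErr_mul_div M').const_mul 2)).sub (hE1.const_mul ((2 : ℝ) * r))
    exact tendsto_log_linear_div (c := (2 : ℝ) * M') (d := 2) (by positivity) zero_le_two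
  simp only [mul_zero, add_zero, sub_zero] at hE
  have hmain := (tendsto_const_nhds : Tendsto (fun _ : ℕ => L) atTop (𝓝 L)).add hE
  rw [add_zero] at hmain
  refine hmain.congr' ?_
  filter_upwards [eventually_ne_atTop 0] with n hn
  have hn' : (n : ℝ) ≠ 0 := by exact_mod_cast hn
  rw [log_laiGAbsBound_two_mul, log_factorial_eq ((M' + r) * n), log_factorial_eq (M' * n), log_factorial_eq n,
    cast_mul_log_mul (M' + r) n, cast_mul_log_mul M' n, hL, laiBeta]
  push_cast
  field_simp
  ring

/-- `(1/n) log laiGWidth → 0` (the width is polynomial in `n`). [this file] -/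
theorem tendsto_log_laiGWidth_div (J r M : ℕ) (δ : Fin J → ℕ) :
    Tendsto (fun n : ℕ => Real.log ((laiGWidth J r M n δ : ℚ) : ℝ) / n) atTop (𝓝 0) := by
  have hup : Tendsto (fun n : ℕ => Real.log (((2 * r + J * M : ℕ) : ℝ) * n + ((1 + 2 * J : ℕ) : ℝ)) / n)
      atTop (𝓝 0) := tendsto_log_linear_div (by positivity) (by positivity)
  refine tendsto_of_tendsto_of_tendsto_of_le_of_le' tendsto_const_nhds hup (Eventually.of_forall fun n => ?_)
    (Eventually.of_forall fun n => ?_)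
  · exact div_nonneg (Real.log_nonneg (by exact_mod_cast one_le_laiGWidth J r M n δ)) (Nat.cast_nonneg n)
  · refine div_le_div_of_nonneg_right (Real.log_le_log (by exact_mod_cast (one_pos.trans_le
      (one_le_laiGWidth J r M n δ))) ?_) (Nat.cast_nonneg n)
    have h' : ((laiGWidth J r M n δ : ℚ) : ℝ) ≤ ((1 + 2 * r * n + J * (M * n + 2) : ℕ) : ℝ) := by
      exact_mod_cast laiGWidth_le J r M n δ
    convert h' using 1; push_cast; ring

/-! ### The coefficient majorant and its rate -/

/-- The majorant of `|C_n · laiCoef n s|`, uniform in `s`: `(J+1)(Mn+1)² · laiGAbsBound · laiGWidth^J`. [this file] -/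
def laiCoefMajorant (J r M n : ℕ) (δ : Fin J → ℕ) : ℚ :=
  (((J + 1) * (M * n + 1) ^ 2 : ℕ) : ℚ) * (laiGAbsBound J r M n δ * laiGWidth J r M n δ ^ J)

/-- `0 < laiCoefMajorant`. [folklore] -/
theorem laiCoefMajorant_pos (J r M n : ℕ) (δ : Fin J → ℕ) : 0 < laiCoefMajorant J r M n δ := by
  have hB := laiGAbsBound_pos J r M n δ
  have hW := one_pos.trans_le (one_le_laiGWidth J r M n δ)
  unfold laiCoefMajorant; positivity

/-- **`|C_n · laiCoef n s| ≤ laiCoefMajorant`** for the brick data `c` of Lai's `R̃_n(t−1)` and EVERY `s`.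
[cite: Lai2024BallRivoal, Lemma 5.2] (Leibniz form, no Cauchy estimate) -/
theorem abs_laiC_mul_laiCoef_le (J r M n : ℕ) (δ : Fin J → ℕ) (hδ : ∀ j, 2 * δ j ≤ M) (hM : 0 < M)
    {c : ℕ → ℕ → ℕ → ℚ}
    (hc : ∀ t : ℚ, (∀ p : ℕ, p ≤ M * n → t + p + 1 ≠ 0) →
      BallRivoal.pfEval (M * n) J (c n) t =
        ((laiPoly J r M n δ).comp (Polynomial.X + Polynomial.C 1)).eval t / BallRivoal.poch (t + 1) (M * n + 1) ^ J)
    (s : ℕ) : |laiC J r M n δ * laiCoef J M c n s| ≤ laiCoefMajorant J r M n δ :=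
  abs_mul_laiCoef_le_of_pf_bound J M n (laiC J r M n δ) c (laiGAbsBound_nonneg J r M n δ) (one_le_laiGWidth J r M n δ)
    (fun _s hs₁ hsJ _p hp => abs_laiC_mul_pf_le_bound J r M n δ hδ hM hc hp hs₁ hsJ) s

/-- Rate of the majorant: `(1/n) log laiCoefMajorant → β̃` for even `M = 2M'`. [this file] -/
theorem tendsto_log_laiCoefMajorant_div (J r M M' : ℕ) (hMM : M = 2 * M') (δ : Fin J → ℕ) :
    Tendsto (fun n : ℕ => Real.log ((laiCoefMajorant J r M n δ : ℚ) : ℝ) / n) atTop (𝓝 (laiBeta J r M' δ)) := by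
  subst hMM
  have hP : Tendsto (fun n : ℕ => Real.log ((J : ℝ) + 1) / n + 2 * (Real.log ((2 * M' : ℕ) * (n : ℝ) + 1) / n))
      atTop (𝓝 (0 + 2 * 0)) :=
    (tendsto_const_div_atTop_nhds_zero_nat _).add ((tendsto_log_linear_div (by positivity) zero_le_one).const_mul 2)
  have hall := (hP.add (tendsto_log_laiGAbsBound_div J r M' δ)).add
    ((tendsto_log_laiGWidth_div J r (2 * M') δ).const_mul (J : ℝ))
  simp only [mul_zero, add_zero, zero_add] at hall
  refine hall.congr' (Eventually.of_forall fun n => ?_)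
  have hB : (0 : ℝ) < ((laiGAbsBound J r (2 * M') n δ : ℚ) : ℝ) := by
    exact_mod_cast laiGAbsBound_pos J r (2 * M') n δ
  have hW : (0 : ℝ) < ((laiGWidth J r (2 * M') n δ : ℚ) : ℝ) := by
    exact_mod_cast one_pos.trans_le (one_le_laiGWidth J r (2 * M') n δ)
  unfold laiCoefMajorant
  push_cast
  rw [Real.log_mul (by positivity) (by positivity), Real.log_mul (by positivity) (by positivity), Real.log_pow,
    Real.log_mul hB.ne' (by positivity), Real.log_pow]
  push_cast
  ring

/-! ### The `growth` field -/

/-- **The skeleton's `growth` field for the brick data**: for even `M = 2M'`, every `s` and every `β' > β̃`,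
`|C_n · laiCoef n s| ≤ e^{β' n}` for all large `n`. [cite: Lai2024BallRivoal, Lemma 5.2] (our uniform-in-`s` form) -/
theorem laiCoef_growth (J r M M' : ℕ) (hMM : M = 2 * M') (δ : Fin J → ℕ) (hδ : ∀ j, 2 * δ j ≤ M) (hM : 0 < M)
    (c : ℕ → ℕ → ℕ → ℚ)
    (hc : ∀ n : ℕ, ∀ t : ℚ, (∀ p : ℕ, p ≤ M * n → t + p + 1 ≠ 0) →
      BallRivoal.pfEval (M * n) J (c n) t =
        ((laiPoly J r M n δ).comp (Polynomial.X + Polynomial.C 1)).eval t / BallRivoal.poch (t + 1) (M * n + 1) ^ J)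
    (s : ℕ) (β' : ℝ) (hβ : laiBeta J r M' δ < β') :
    ∀ᶠ n : ℕ in atTop, |((laiC J r M n δ * laiCoef J M c n s : ℚ) : ℝ)| ≤ Real.exp (β' * n) := by
  have hpos : ∀ n, (0 : ℝ) < ((laiCoefMajorant J r M n δ : ℚ) : ℝ) := fun n => by
    exact_mod_cast laiCoefMajorant_pos J r M n δ
  filter_upwards [eventually_le_exp_mul_of_tendsto_log_div hpos (tendsto_log_laiCoefMajorant_div J r M M' hMM δ) hβ]
    with n hn
  have h' : |((laiC J r M n δ * laiCoef J M c n s : ℚ) : ℝ)| ≤ ((laiCoefMajorant J r M n δ : ℚ) : ℝ) := by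
    rw [← Rat.cast_abs]; exact_mod_cast abs_laiC_mul_laiCoef_le J r M n δ hδ hM (hc n) s
  exact h'.trans hn

end

section Kappa3

/-! ## The κ₃ candidate `J = 74` (`r = 2180`, `M = 444 = 2·222`): the `β` / `growth` inputs, instantiated

MANUSCRIPT-LEVEL CANDIDATE, NOT certified (families/indep/FAMILY.md §5.13): this section instantiates the growth
theorems at the candidate point; no margin or dimension statement. -/

/-- `β̃` at the candidate point: `laiBeta 74 2180 222 δ74`. [this file] -/
noncomputable def kappa3Beta : ℝ := laiBeta 74 2180 222 δ74

/-- `Σ_j (444 − 2δ_j) = 26070` at the candidate point. [this file] -/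
theorem sum_sub_two_mul_δ74 : ∑ j, (2 * 222 - 2 * δ74 j) = 26070 := by
  set_option maxRecDepth 10000 in decide

/-- Closed form: `β̃ = 4804 log 2402 − 444 log 222 + 26070 log 2`. [cite: Lai2024BallRivoal, §13 p. 49] (at our point) -/
theorem kappa3Beta_eq : kappa3Beta = 4804 * Real.log 2402 - 444 * Real.log 222 + 26070 * Real.log 2 := by
  have hs : (∑ j : Fin 74, (((2 * 222 - 2 * δ74 j : ℕ)) : ℝ)) = 26070 := by
    rw [← Nat.cast_sum, sum_sub_two_mul_δ74]; norm_num
  unfold kappa3Beta laiBeta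
  rw [hs]
  norm_num
  ring

/-- **`growth` at the candidate point**: for every `s` and every `β' > β̃ = kappa3Beta`,
`|C_n · laiCoef 74 444 kappa3Coef n s| ≤ e^{β' n}` for all large `n`. [this file] -/
theorem kappa3_growth (s : ℕ) (β' : ℝ) (hβ : kappa3Beta < β') :
    ∀ᶠ n : ℕ in atTop,
      |((laiC 74 2180 444 n δ74 * laiCoef 74 444 kappa3Coef n s : ℚ) : ℝ)| ≤ Real.exp (β' * n) :=
  laiCoef_growth 74 2180 444 222 (by norm_num) δ74 two_mul_δ74_le (by norm_num) kappa3Coef kappa3Coef_spec s β' hβ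

open LogEnclosures in
/-- **Certified enclosure** `53066.168 ≤ β̃ ≤ 53066.1682` (`log 2402 = 5log2 + log3 + 2log5 + log(1+1/1200)`,
`log 222 = 2log3 + 2log5 + log(1−1/75)`, series remainders; KAPPA3.md §7: `β̃ = 53066.16808032870…`). [this file] -/
theorem kappa3Beta_bounds : (53066168 / 1000 : ℝ) ≤ kappa3Beta ∧ kappa3Beta ≤ (530661682 / 10000 : ℝ) := by
  have hx : |(-1 / 1200 : ℝ)| < 1 := by rw [abs_of_neg (by norm_num : (-1 / 1200 : ℝ) < 0)]; norm_num
  have h := log_one_sub_bounds hx 2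
  rw [abs_of_neg (by norm_num : (-1 / 1200 : ℝ) < 0)] at h
  simp only [sum_range_succ, sum_range_zero] at h
  norm_num at h
  have hy : |(1 / 75 : ℝ)| < 1 := by rw [abs_of_pos (by norm_num : (0 : ℝ) < 1 / 75)]; norm_num
  have h' := log_one_sub_bounds hy 4
  rw [abs_of_pos (by norm_num : (0 : ℝ) < 1 / 75)] at h'
  simp only [sum_range_succ, sum_range_zero] at h'
  norm_num at h'
  have h2402 : Real.log (2402 : ℝ) = 5 * Real.log 2 + Real.log 3 + 2 * Real.log 5 + Real.log (1 - (-1 / 1200)) := by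
    rw [show (2402 : ℝ) = (2 : ℝ) ^ 5 * (3 : ℝ) * (5 : ℝ) ^ 2 * (1 - (-1 / 1200)) by norm_num]
    rw [Real.log_mul (by positivity) (by norm_num), Real.log_mul (by positivity) (by positivity),
      Real.log_mul (by positivity) (by positivity), Real.log_pow, Real.log_pow]
    push_cast
    ring
  have h222 : Real.log (222 : ℝ) = 2 * Real.log 3 + 2 * Real.log 5 + Real.log (1 - 1 / 75) := by
    rw [show (222 : ℝ) = (3 : ℝ) ^ 2 * (5 : ℝ) ^ 2 * (1 - 1 / 75) by norm_num]
    rw [Real.log_mul (by positivity) (by norm_num), Real.log_mul (by positivity) (by positivity), Real.log_pow,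
      Real.log_pow]
    push_cast
    ring
  obtain ⟨p1, p2⟩ := log_two_bounds
  obtain ⟨q1, q2⟩ := log_three_bounds
  obtain ⟨r1, r2⟩ := log_five_bounds
  rw [kappa3Beta_eq, h2402, h222]
  constructor <;> linarith [h.1, h.2, h'.1, h'.2]

end Kappa3

end Summit.KontsevichZagierPeriods.Zeta5Search
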